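import Mathlib
import HarnessLib
import Literature.AlgebraicGeometry.HyperbolicPolynomials.SpectrahedralShadow
import Summits.ValiantsHypothesis.ValiantsHypothesis.Theorems.PermanentalConesHyperbolicVPShadowStubRealifyHermitianPencil
import Summits.ValiantsHypothesis.ValiantsHypothesis.Theorems.PermanentalConesHyperbolicVPShadowStubSpectrahedronOfSymmDetPower

/-!
# ValiantsHypothesis / PermanentalCones — `HyperbolicVPShadow`, stub D₄ʰ

Route `PermanentalCones`, item `stmt-ValiantsHypothesis-8655` (crux `HyperbolicVPShadow`), line
`birth`, stub `stub_oshimeFamilyD4h_spectrahedron`.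

Family (D4) of Oshime's classification of the irreducible, non-symmetrisable linear pencils of
real `3 × 3` matrices with only real eigenvalues (Oshime, J. Math. Kyoto Univ. 31 (1991),
part (II), Prop. 5.13 / Thm. 6.3 (4)) is, in homogenised form, the `4`-variable pencil
`P(x) = x₀·1 + x₁ A + x₂ B + x₃ C` with

  `A = E₁₁ + E₂₃ = !![1, 0, 0; 0, 0, 1; 0, 0, 0]`, `B = !![ρ, 1, -a; a, 0, 0; -1, 0, 0]`,
  `C = diag (σ, 1, -1)`,

which has only real eigenvalues iff `2a − 1 ≥ 0` and `ρ² + σ² ≤ (2a − 1)²`. We show that for all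
such parameters its closed nonnegative-spectrum cone `{x : ∀ τ > 0, det (P x + τ·1) ≠ 0}` is a
lifted-LMI set of size `6`.

## Proof

Write `t := τ + x₀`, `(x, y, z) := (x₁, x₂, x₃)`. Then
`det (P x + τ·1) = (t + x + ρ y + σ z)(t² − z²) − 2 a t y² − x y²`. There is a *Hermitian*
determinantal certificate: real numbers `u, c, d` with

  `u² = (2a − 1 + ρ)/2`, `c² + d² = (2a − 1 − ρ)/2`, `2 u c = σ`

(`permanentalCones_oshimeD4h_certificate`; they exist since `|ρ| ≤ 2a − 1`, with the degenerate
case `2a − 1 + ρ = 0`, forcing `σ = 0`, treated separately), for which the Hermitian matrix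
`H = !![t + x + ρ y + σ z, u y, (c − d i) y; u y, t + y, z; (c + d i) y, z, t − y]` satisfies
`det H = det (P x + τ·1)` identically (`permanentalCones_oshimeD4h_detIdentity`, a polynomial
identity modulo the three relations). Realifying the Hermitian pencil
(`stub_realify_hermitianPencil`) gives a real symmetric pencil `L` of size `2·3` with
`det (L x + τ·1) = det (P x + τ·1)²`, and `stub_spectrahedron_of_symmDetPower` (`k = 2`) turns
this into a size-`6` lifted-LMI description of the cone. No definitions are introduced: all
matrices are literals, the two pencils are `Fintype.linearCombination ℝ ![…]`.
-/

-- `<Problem> = <Summit>` for this single-conjunct summit (lakefile sets the same option tree-wide).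
set_option linter.dupNamespace false

namespace Summit.ValiantsHypothesis.ValiantsHypothesis.Theorems

open Matrix Complex

/-- **Parameters of the Hermitian certificate for Oshime's family (D4).** If `1 ≤ 2a` and
`ρ² + σ² ≤ (2a − 1)²`, then there are real `u, c, d` with `u² = (2a − 1 + ρ)/2`,
`c² + d² = (2a − 1 − ρ)/2` and `2uc = σ` (certificate for Oshime 1991 (II), Prop. 5.13,
family (D4); the case `2a − 1 + ρ = 0` forces `σ = 0`). [folklore] -/
theorem permanentalCones_oshimeD4h_certificate (a ρ σ : ℝ) (ha : 1 ≤ 2 * a)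
    (hρσ : ρ ^ 2 + σ ^ 2 ≤ (2 * a - 1) ^ 2) :
    ∃ u c d : ℝ, u ^ 2 = (2 * a - 1 + ρ) / 2 ∧ c ^ 2 + d ^ 2 = (2 * a - 1 - ρ) / 2 ∧
      2 * u * c = σ := by
  have hρ2 : ρ ^ 2 ≤ (2 * a - 1) ^ 2 := le_trans (le_add_of_nonneg_right (sq_nonneg σ)) hρσ
  obtain ⟨hρl, hρu⟩ := abs_le_of_sq_le_sq' hρ2 (by linarith)
  have hm : 0 ≤ (2 * a - 1 - ρ) / 2 := by linarith
  rcases eq_or_lt_of_le (show 0 ≤ 2 * a - 1 + ρ by linarith) with h0 | hpos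
  · -- degenerate case `ρ = 1 - 2a`: then `σ = 0`, take `u = c = 0`
    have hprod : (2 * a - 1 - ρ) * (2 * a - 1 + ρ) = 0 := by rw [← h0, mul_zero]
    have hσ2 : σ ^ 2 = 0 := le_antisymm (by linarith) (sq_nonneg σ)
    have hσ : σ = 0 := (pow_eq_zero_iff two_ne_zero).1 hσ2
    refine ⟨0, 0, Real.sqrt ((2 * a - 1 - ρ) / 2), ?_, ?_, ?_⟩
    · rw [← h0]; norm_num
    · rw [Real.sq_sqrt hm]; ring
    · rw [hσ]; ring
  · obtain ⟨u, hu0, usq⟩ : ∃ u : ℝ, 0 < u ∧ u ^ 2 = (2 * a - 1 + ρ) / 2 :=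
      ⟨Real.sqrt _, Real.sqrt_pos.2 (by linarith), Real.sq_sqrt (by linarith)⟩
    obtain ⟨c, hc⟩ : ∃ c : ℝ, c = σ / (2 * u) := ⟨_, rfl⟩
    have R3 : 2 * u * c = σ := by rw [hc]; field_simp
    have key : 2 * (2 * a - 1 + ρ) * c ^ 2 = σ ^ 2 := by
      rw [← R3]; linear_combination (-4 * c ^ 2) * usq
    have hd : 0 ≤ (2 * a - 1 - ρ) / 2 - c ^ 2 := by
      have h2 : (0 : ℝ) < 2 * (2 * a - 1 + ρ) := by linarith
      have h3 : 2 * (2 * a - 1 + ρ) * c ^ 2 ≤ 2 * (2 * a - 1 + ρ) * ((2 * a - 1 - ρ) / 2) := by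
        rw [key]; linarith
      exact sub_nonneg.2 (le_of_mul_le_mul_left h3 h2)
    obtain ⟨d, dsq⟩ : ∃ d : ℝ, d ^ 2 = (2 * a - 1 - ρ) / 2 - c ^ 2 :=
      ⟨Real.sqrt _, Real.sq_sqrt hd⟩
    exact ⟨u, c, d, usq, by rw [dsq]; ring, R3⟩

/-- **The Hermitian determinantal identity for Oshime's family (D4).** Under the three relations
of `permanentalCones_oshimeD4h_certificate`, for all real `τ, x₀, x₁, x₂, x₃`,
`det ((τ + x₀)·1 + x₁ A' + x₂ B' + x₃ C') = det ((τ + x₀)·1 + x₁ A + x₂ B + x₃ C)` for the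
Hermitian matrices `A' = E₁₁`, `B' = !![ρ, u, c − d i; u, 1, 0; c + d i, 0, −1]`,
`C' = !![σ, 0, 0; 0, 0, 1; 0, 1, 0]`, both sides written out as explicit `3 × 3` matrices
(Oshime 1991 (II), Prop. 5.13, family (D4)). [folklore] -/
theorem permanentalCones_oshimeD4h_detIdentity (a ρ σ u c d : ℝ)
    (R1 : u ^ 2 = (2 * a - 1 + ρ) / 2) (R2 : c ^ 2 + d ^ 2 = (2 * a - 1 - ρ) / 2)
    (R3 : 2 * u * c = σ) (τ x₀ x₁ x₂ x₃ : ℝ) :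
    (!![(τ : ℂ) + x₀ + x₁ + ρ * x₂ + σ * x₃, u * x₂, x₂ * (c - d * I);
        u * x₂, (τ : ℂ) + x₀ + x₂, x₃;
        x₂ * (c + d * I), x₃, (τ : ℂ) + x₀ - x₂]).det =
      ((!![τ + x₀ + x₁ + ρ * x₂ + σ * x₃, x₂, -(a * x₂); a * x₂, τ + x₀ + x₃, x₁;
          -x₂, 0, τ + x₀ - x₃]).det : ℂ) := by
  have R1c : (u : ℂ) ^ 2 = (2 * a - 1 + ρ) / 2 := by exact_mod_cast R1
  have R2c : (c : ℂ) ^ 2 + d ^ 2 = (2 * a - 1 - ρ) / 2 := by exact_mod_cast R2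
  have R3c : 2 * (u : ℂ) * c = σ := by exact_mod_cast R3
  simp only [Matrix.det_fin_three, Matrix.of_apply, Matrix.cons_val', Matrix.cons_val_zero,
    Matrix.cons_val_one, Matrix.cons_val_two, Matrix.head_cons, Matrix.tail_cons,
    Matrix.empty_val', Matrix.cons_val_fin_one, Matrix.head_fin_const]
  push_cast
  -- the two cofactor expansions differ by `x₂² (x₂ - t) ρ₁ - x₂² (t + x₂) ρ₂ + x₂² x₃ ρ₃`
  -- (`t = τ + x₀`, `ρᵢ` the defects of the three relations), plus a multiple of `I² + 1`
  linear_combination ((x₂ : ℂ) ^ 3 - x₂ ^ 2 * (τ + x₀)) * R1c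
    + (-((x₂ : ℂ) ^ 2 * (τ + x₀)) - x₂ ^ 3) * R2c + ((x₂ : ℂ) ^ 2 * x₃) * R3c
    + ((d : ℂ) ^ 2 * x₂ ^ 2 * (τ + x₀ + x₂)) * I_sq

/-- **Stub (Oshime's family (D4) has size-`6` spectrahedral cones).** For `1 ≤ 2a` and
`ρ² + σ² ≤ (2a − 1)²`, the closed nonnegative-spectrum cone
`{x : ∀ τ > 0, det (x₀·1 + x₁ A + x₂ B + x₃ C + τ·1) ≠ 0}` of the homogenised real-spectrum
pencil `A = E₁₁ + E₂₃`, `B = !![ρ, 1, -a; a, 0, 0; -1, 0, 0]`, `C = diag (σ, 1, -1)`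
(Oshime 1991 (II), Prop. 5.13 / Thm. 6.3 (4), family (D4)) is a lifted-LMI set of size `6`:
a Hermitian `3 × 3` determinantal representation, realified to a symmetric `6 × 6`
representation of the square of `det (P x + τ·1)`. [folklore] -/
theorem stub_oshimeFamilyD4h_spectrahedron :
    ∀ a ρ σ : ℝ, 1 ≤ 2 * a → ρ ^ 2 + σ ^ 2 ≤ (2 * a - 1) ^ 2 →
      Literature.AlgebraicGeometry.HyperbolicPolynomials.IsSpectrahedralShadowOfSize
        {x : Fin 4 → ℝ | ∀ τ : ℝ, 0 < τ →
          (x 0 • (1 : Matrix (Fin 3) (Fin 3) ℝ) + x 1 • !![(1 : ℝ), 0, 0; 0, 0, 1; 0, 0, 0] +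
            x 2 • !![ρ, 1, -a; a, 0, 0; -1, 0, 0] +
            x 3 • !![σ, 0, 0; 0, 1, 0; 0, 0, -1] +
            τ • (1 : Matrix (Fin 3) (Fin 3) ℝ)).det ≠ 0} 6 := by
  intro a ρ σ ha hρσ
  obtain ⟨u, c, d, R1, R2, R3⟩ := permanentalCones_oshimeD4h_certificate a ρ σ ha hρσ
  -- the real pencil `P x = x 0 • 1 + x 1 • A + x 2 • B + x 3 • C`
  let P : (Fin 4 → ℝ) →ₗ[ℝ] Matrix (Fin 3) (Fin 3) ℝ := Fintype.linearCombination ℝ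
    ![(1 : Matrix (Fin 3) (Fin 3) ℝ), !![(1 : ℝ), 0, 0; 0, 0, 1; 0, 0, 0],
      !![ρ, 1, -a; a, 0, 0; -1, 0, 0], !![σ, 0, 0; 0, 1, 0; 0, 0, -1]]
  have hP : ∀ x : Fin 4 → ℝ, P x = x 0 • (1 : Matrix (Fin 3) (Fin 3) ℝ) +
      x 1 • !![(1 : ℝ), 0, 0; 0, 0, 1; 0, 0, 0] + x 2 • !![ρ, 1, -a; a, 0, 0; -1, 0, 0] +
      x 3 • !![σ, 0, 0; 0, 1, 0; 0, 0, -1] := fun x => by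
    simp only [P, Fintype.linearCombination_apply, Fin.sum_univ_four, Matrix.cons_val]
  have hPx : ∀ (x : Fin 4 → ℝ) (τ : ℝ), P x + τ • (1 : Matrix (Fin 3) (Fin 3) ℝ) =
      !![τ + x 0 + x 1 + ρ * x 2 + σ * x 3, x 2, -(a * x 2); a * x 2, τ + x 0 + x 3, x 1;
        -x 2, 0, τ + x 0 - x 3] := fun x τ => by
    rw [hP]
    ext i j
    fin_cases i <;> fin_cases j <;> simp <;> ring
  -- the Hermitian pencil `H x = x 0 • 1 + x 1 • A' + x 2 • B' + x 3 • C'`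
  let Aℂ : Matrix (Fin 3) (Fin 3) ℂ := !![1, 0, 0; 0, 0, 0; 0, 0, 0]
  let Bℂ : Matrix (Fin 3) (Fin 3) ℂ :=
    !![(ρ : ℂ), u, c - d * I; u, 1, 0; c + d * I, 0, -1]
  let Cℂ : Matrix (Fin 3) (Fin 3) ℂ := !![(σ : ℂ), 0, 0; 0, 0, 1; 0, 1, 0]
  have h1h : (1 : Matrix (Fin 3) (Fin 3) ℂ).IsHermitian := Matrix.isHermitian_one
  have hAh : Aℂ.IsHermitian := Matrix.IsHermitian.ext fun i j => by
    fin_cases i <;> fin_cases j <;> simp [Aℂ]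
  have hBh : Bℂ.IsHermitian := Matrix.IsHermitian.ext fun i j => by
    fin_cases i <;> fin_cases j <;> simp [Bℂ, Complex.ext_iff]
  have hCh : Cℂ.IsHermitian := Matrix.IsHermitian.ext fun i j => by
    fin_cases i <;> fin_cases j <;> simp [Cℂ]
  let H : (Fin 4 → ℝ) →ₗ[ℝ] Matrix (Fin 3) (Fin 3) ℂ :=
    Fintype.linearCombination ℝ ![(1 : Matrix (Fin 3) (Fin 3) ℂ), Aℂ, Bℂ, Cℂ]
  have hH : ∀ x : Fin 4 → ℝ,
      H x = x 0 • (1 : Matrix (Fin 3) (Fin 3) ℂ) + x 1 • Aℂ + x 2 • Bℂ + x 3 • Cℂ := fun x => by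
    simp only [H, Fintype.linearCombination_apply, Fin.sum_univ_four, Matrix.cons_val]
  have hHerm : ∀ x : Fin 4 → ℝ, (H x).IsHermitian := fun x => by
    rw [hH]
    exact (((h1h.smul (IsSelfAdjoint.all _)).add (hAh.smul (IsSelfAdjoint.all _))).add
      (hBh.smul (IsSelfAdjoint.all _))).add (hCh.smul (IsSelfAdjoint.all _))
  have hHx : ∀ (x : Fin 4 → ℝ) (τ : ℝ), H x + (τ : ℂ) • (1 : Matrix (Fin 3) (Fin 3) ℂ) =
      !![(τ : ℂ) + x 0 + x 1 + ρ * x 2 + σ * x 3, u * x 2, x 2 * (c - d * I);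
        u * x 2, (τ : ℂ) + x 0 + x 2, x 3;
        x 2 * (c + d * I), x 3, (τ : ℂ) + x 0 - x 2] := fun x τ => by
    rw [hH]
    ext i j
    fin_cases i <;> fin_cases j <;> simp [Aℂ, Bℂ, Cℂ, Matrix.smul_apply] <;> ring
  -- the determinantal identity `det (H x + τ·1) = det (P x + τ·1)`
  have hdet : ∀ (x : Fin 4 → ℝ) (τ : ℝ), (H x + (τ : ℂ) • (1 : Matrix (Fin 3) (Fin 3) ℂ)).det =
      (((P x + τ • (1 : Matrix (Fin 3) (Fin 3) ℝ)).det : ℝ) : ℂ) := fun x τ => by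
    rw [hHx, hPx]
    exact permanentalCones_oshimeD4h_detIdentity a ρ σ u c d R1 R2 R3 τ (x 0) (x 1) (x 2) (x 3)
  -- realification: a symmetric pencil of size `2·3` representing the square of `det (P x + τ·1)`
  obtain ⟨L, hLsymm, hLdet⟩ := stub_realify_hermitianPencil 4 3 H hHerm
  have hLdet' : ∀ (x : Fin 4 → ℝ) (τ : ℝ),
      (L x + τ • (1 : Matrix (Fin (2 * 3)) (Fin (2 * 3)) ℝ)).det =
        ((P x + τ • (1 : Matrix (Fin 3) (Fin 3) ℝ)).det) ^ 2 := fun x τ => by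
    have h := hLdet x τ
    simp only [Complex.coe_algebraMap] at h
    have hs : star (((P x + τ • (1 : Matrix (Fin 3) (Fin 3) ℝ)).det : ℝ) : ℂ) =
        ((P x + τ • (1 : Matrix (Fin 3) (Fin 3) ℝ)).det : ℝ) := Complex.conj_ofReal _
    rw [hdet x τ, hs, ← Complex.ofReal_mul] at h
    rw [sq]
    exact_mod_cast h
  have h6 := stub_spectrahedron_of_symmDetPower 4 3 (2 * 3) 2 P L two_ne_zero hLsymm hLdet'
  simp only [hP] at h6
  exact h6

end Summit.ValiantsHypothesis.ValiantsHypothesis.Theorems
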